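import Summits.ValiantsHypothesis.ValiantsHypothesis.Theorems.KPlusLogSqLawMixedGaugeUpwardLaw

/-!
# Route «KPlusLogSqLaw», `WeakLifting` (stmt-ValiantsHypothesis-19561) — THE TWO-CLASS LAW at ratio 3, `ζ ≤ n + 2m`,
# from the upward law and ONE classical positivity (the cube-root Loewner kernel)

HONEST FRAMING.  Helper file (seat val-sym-lift-p4 g26, cell `pub-symmetroid`, 2026-08-29; `--supports 19561 --as helper`, zero crux
credit), fourth of the seat's mixed-gauge series.  Object: `M(x) = [[A + x^a·1ₙ, B], [Bᵀ, C − x^{3a}·1ₘ]]`, `A ∈ Sym(n)`, `C ∈ Sym(m)`,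
`B` arbitrary.  LOCATED LAW (memo MIXED-GAUGE-LAW.md): at most `n + 2m` positive determinant zeros, split as `n + m` upward + `m`
downward in every extremiser; Descartes' count for this family is about `n + 3m`.  The UPWARD half `≤ n + m` is the tree's
`MixedGauge.card_up_le_blocks` (✓ third file).  THIS FILE: (1) the DOWNWARD HALF `≤ m` — `m + 1` distinct positive zeros carrying
downward kernel vectors (`‖w‖² ≤ 3 s² ‖q‖²`) give a relation `Σ cⱼ qⱼ = 0` among the fast components (`m + 1` vectors in `ℝᵐ`), and
`0 = ‖Σ cⱼ qⱼ‖²` expands, through the two-point identity `⟪qⱼ,qₖ⟫ = ⟪wⱼ,wₖ⟫/(sⱼ² + sⱼsₖ + sₖ²)` (`j ≠ k`), into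
`Σ_i Σⱼₖ (cⱼwⱼ(i))(cₖwₖ(i))/(sⱼ² + sⱼsₖ + sₖ²) + Σⱼ cⱼ²(‖qⱼ‖² − ‖wⱼ‖²/(3sⱼ²))` — a sum of a CUBE-ROOT LOEWNER FORM and non-negative
terms; (2) hence the COUNT `ζ ≤ n + 2m` (`card_posZeros_le_blocks_of_cubeLoewner`, determinant currency
`card_posRoots_det_blockPencil_le_of_cubeLoewner`).  CONDITIONAL — SAID UP FRONT: both (1) and (2) take as an explicit inline
hypothesis `hK` the STRICT POSITIVE DEFINITENESS of the kernel `1/(x² + xy + y²)` on pairwise distinct positive reals,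
`∀ k (x c : Fin k → ℝ), (∀ i, 0 < x i) → x injective → c ≠ 0 → 0 < Σⱼ Σₗ cⱼ cₗ /(xⱼ² + xⱼxₗ + xₗ²)` — the Loewner matrix of
`t ↦ t^{1/3}` at the points `xⱼ³`, positive definite by Löwner–Heinz (operator monotonicity of cube root; elementary route:
`1/(x² + xy + y²) = I⁻¹ ∫₀^∞ μ³ dμ /((x³ + μ³)(y³ + μ³))`, `I = ∫₀^∞ ds/(1 + s³)`).  `hK` is NOT a tree theorem at this revision; the
audit classes these declarations conditional; nothing here is credited to the crux.  A successor discharging `hK` turns (2) into the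
unconditional two-class law at ratio 3.  Nothing here is about `WeakLifting` / `TropicalB` in their windows, the doors,
`MatrixDescartes` (18050) or VP ≠ VNP.  No `def`; axioms standard.  [Löwner 1934 / Heinz 1951 for `hK`; the count law appears new]
-/

set_option linter.dupNamespace false
set_option autoImplicit false

namespace Summit.ValiantsHypothesis.ValiantsHypothesis.Theorems.KPlusLogSqLaw

open Matrix Finset
open scoped BigOperators

namespace MixedGauge

variable {n m : ℕ}

/-! ## 1. The downward half, from the cube-root Loewner positivity -/

/-- **Downward law at ratio 3 (conditional on `hK`).**  Given strict positive definiteness of `1/(x² + xy + y²)` on distinct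
positive points, `m + 1` pairwise distinct positive `sⱼ` with NON-ZERO kernel data `(wⱼ, qⱼ)`, `qⱼ ∈ ℝᵐ`, the pairwise two-point
identities `(sₖ − sⱼ)·⟪wⱼ,wₖ⟫ = (sₖ³ − sⱼ³)·⟪qⱼ,qₖ⟫` and all DOWNWARD (`‖wⱼ‖² ≤ 3 sⱼ² ‖qⱼ‖²`) cannot exist. -/
theorem down_card_le_blocks_of_cubeLoewner
    (hK : ∀ (k : ℕ) (x c : Fin k → ℝ), (∀ i, 0 < x i) → Function.Injective x → c ≠ 0 →
      0 < ∑ j, ∑ l, c j * c l / (x j ^ 2 + x j * x l + x l ^ 2))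
    (s : Fin (m + 1) → ℝ) (hs : ∀ j, 0 < s j) (hinj : Function.Injective s)
    (w : Fin (m + 1) → (Fin n → ℝ)) (q : Fin (m + 1) → (Fin m → ℝ)) (hnz : ∀ j, w j ≠ 0 ∨ q j ≠ 0)
    (hid : ∀ j k, j ≠ k → (s k - s j) * (w j ⬝ᵥ w k) = (s k ^ 3 - s j ^ 3) * (q j ⬝ᵥ q k))
    (hdown : ∀ j, w j ⬝ᵥ w j ≤ 3 * s j ^ 2 * (q j ⬝ᵥ q j)) : False := by
  classical
  -- a relation among the m + 1 fast components in ℝᵐ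
  let f : (Fin (m + 1) → ℝ) →ₗ[ℝ] (Fin m → ℝ) :=
    { toFun := fun d => ∑ j, d j • q j
      map_add' := by
        intro d d'
        simp only [Pi.add_apply, add_smul, Finset.sum_add_distrib]
      map_smul' := by
        intro r d
        simp only [Pi.smul_apply, smul_eq_mul, mul_smul, ← Finset.smul_sum, RingHom.id_apply] }
  have hker : LinearMap.ker f ≠ ⊥ := by
    apply LinearMap.ker_ne_bot_of_finrank_lt
    rw [Module.finrank_fin_fun, Module.finrank_fin_fun]
    omega
  obtain ⟨c, hcker, hc0⟩ := (Submodule.ne_bot_iff _).mp hker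
  have hsumq : ∑ j, c j • q j = 0 := LinearMap.mem_ker.mp hcker
  -- the kernel 1/(sⱼ² + sⱼsₖ + sₖ²)
  have hmpos : ∀ j k, 0 < s j ^ 2 + s j * s k + s k ^ 2 := by
    intro j k
    have := hs j; have := hs k
    positivity
  -- off-diagonal: ⟪qⱼ,qₖ⟫ = ⟪wⱼ,wₖ⟫ / mⱼₖ
  have hG : ∀ j k, j ≠ k → q j ⬝ᵥ q k = (w j ⬝ᵥ w k) / (s j ^ 2 + s j * s k + s k ^ 2) := by
    intro j k hjk
    have hne : s k - s j ≠ 0 := sub_ne_zero.mpr (fun h => hjk (hinj h).symm)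
    have h := hid j k hjk
    have h' : (s k - s j) * (w j ⬝ᵥ w k) = (s k - s j) * ((s j ^ 2 + s j * s k + s k ^ 2) * (q j ⬝ᵥ q k)) := by
      rw [h]; ring
    have h'' := mul_left_cancel₀ hne h'
    rw [eq_div_iff (ne_of_gt (hmpos j k)), h'']
    ring
  -- expand 0 = ‖Σ cⱼ qⱼ‖²
  have hzero : (∑ j, c j • q j) ⬝ᵥ (∑ k, c k • q k) = 0 := by rw [hsumq, dotProduct_zero]
  have hexp : (∑ j, c j • q j) ⬝ᵥ (∑ k, c k • q k) = ∑ j, ∑ k, c j * c k * (q j ⬝ᵥ q k) := by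
    rw [sum_dotProduct]
    refine Finset.sum_congr rfl fun j _ => ?_
    rw [dotProduct_sum]
    refine Finset.sum_congr rfl fun k _ => ?_
    rw [smul_dotProduct, dotProduct_smul, smul_eq_mul, smul_eq_mul]
    ring
  have hterm : ∀ j k, c j * c k * (q j ⬝ᵥ q k) =
      (∑ i, (c j * w j i) * (c k * w k i) / (s j ^ 2 + s j * s k + s k ^ 2))
        + (if j = k then c j ^ 2 * (q j ⬝ᵥ q j - (w j ⬝ᵥ w j) / (3 * s j ^ 2)) else 0) := by
    intro j k
    have hsum : ∑ i, (c j * w j i) * (c k * w k i) / (s j ^ 2 + s j * s k + s k ^ 2) =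
        c j * c k * (w j ⬝ᵥ w k) / (s j ^ 2 + s j * s k + s k ^ 2) := by
      rw [dotProduct, Finset.mul_sum, Finset.sum_div]
      refine Finset.sum_congr rfl fun i _ => ?_
      ring
    rw [hsum]
    by_cases hjk : j = k
    · subst hjk
      rw [if_pos rfl]
      have hsj : s j ≠ 0 := ne_of_gt (hs j)
      field_simp
      ring
    · rw [if_neg hjk, add_zero, hG j k hjk]
      ring
  have hdouble : ∑ j, ∑ k, c j * c k * (q j ⬝ᵥ q k) =
      (∑ j, ∑ k, ∑ i, (c j * w j i) * (c k * w k i) / (s j ^ 2 + s j * s k + s k ^ 2))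
        + ∑ j, c j ^ 2 * (q j ⬝ᵥ q j - (w j ⬝ᵥ w j) / (3 * s j ^ 2)) := by
    simp_rw [hterm, Finset.sum_add_distrib, Finset.sum_ite_eq, Finset.mem_univ, if_true]
  -- the first block is a sum over coordinates of cube-root Loewner forms (each ≥ 0, > 0 unless the coordinate vector vanishes)
  have hcomm : ∑ j, ∑ k, ∑ i, (c j * w j i) * (c k * w k i) / (s j ^ 2 + s j * s k + s k ^ 2) =
      ∑ i, ∑ j, ∑ k, (c j * w j i) * (c k * w k i) / (s j ^ 2 + s j * s k + s k ^ 2) := by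
    calc (∑ j, ∑ k, ∑ i, (c j * w j i) * (c k * w k i) / (s j ^ 2 + s j * s k + s k ^ 2))
        = ∑ j, ∑ i, ∑ k, (c j * w j i) * (c k * w k i) / (s j ^ 2 + s j * s k + s k ^ 2) :=
          Finset.sum_congr rfl fun j _ => Finset.sum_comm
      _ = ∑ i, ∑ j, ∑ k, (c j * w j i) * (c k * w k i) / (s j ^ 2 + s j * s k + s k ^ 2) := Finset.sum_comm
  have hKi : ∀ i, 0 ≤ ∑ j, ∑ k, (c j * w j i) * (c k * w k i) / (s j ^ 2 + s j * s k + s k ^ 2) := by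
    intro i
    by_cases hci : (fun j => c j * w j i) = 0
    · have h0 : ∀ j, c j * w j i = 0 := fun j => congrFun hci j
      simp only [h0, zero_mul, zero_div, Finset.sum_const_zero, le_refl]
    · exact le_of_lt (hK (m + 1) s (fun j => c j * w j i) hs hinj hci)
  have hA : 0 ≤ ∑ j, ∑ k, ∑ i, (c j * w j i) * (c k * w k i) / (s j ^ 2 + s j * s k + s k ^ 2) := by
    rw [hcomm]; exact Finset.sum_nonneg fun i _ => hKi i
  have hexcess : ∀ j, 0 ≤ q j ⬝ᵥ q j - (w j ⬝ᵥ w j) / (3 * s j ^ 2) := by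
    intro j
    have h3 : 0 < 3 * s j ^ 2 := by have := hs j; positivity
    rw [sub_nonneg, div_le_iff₀ h3]
    linarith [hdown j]
  have hB : 0 ≤ ∑ j, c j ^ 2 * (q j ⬝ᵥ q j - (w j ⬝ᵥ w j) / (3 * s j ^ 2)) :=
    Finset.sum_nonneg fun j _ => mul_nonneg (sq_nonneg _) (hexcess j)
  rw [hexp, hdouble] at hzero
  have hA0 : ∑ j, ∑ k, ∑ i, (c j * w j i) * (c k * w k i) / (s j ^ 2 + s j * s k + s k ^ 2) = 0 := by linarith
  have hB0 : ∑ j, c j ^ 2 * (q j ⬝ᵥ q j - (w j ⬝ᵥ w j) / (3 * s j ^ 2)) = 0 := by linarith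
  -- from hA0 and strictness: every coordinate vector (cⱼ wⱼ(i))ⱼ vanishes
  have hcw : ∀ j i, c j * w j i = 0 := by
    intro j i
    rw [hcomm] at hA0
    have hi0 := (Finset.sum_eq_zero_iff_of_nonneg fun i _ => hKi i).mp hA0 i (Finset.mem_univ _)
    by_contra hne
    have hci : (fun j => c j * w j i) ≠ 0 := fun h => hne (congrFun h j)
    have := hK (m + 1) s (fun j => c j * w j i) hs hinj hci
    linarith
  -- pick j₀ with cⱼ₀ ≠ 0: then wⱼ₀ = 0, and from hB0 also qⱼ₀ = 0
  obtain ⟨j0, hj0⟩ : ∃ j, c j ≠ 0 := by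
    by_contra h
    push Not at h
    exact hc0 (funext h)
  have hw0 : w j0 = 0 := by
    funext i
    have := hcw j0 i
    rcases mul_eq_zero.mp this with h | h
    · exact absurd h hj0
    · exact h
  have hB0' := (Finset.sum_eq_zero_iff_of_nonneg fun j _ => mul_nonneg (sq_nonneg _) (hexcess j)).mp hB0 j0
    (Finset.mem_univ _)
  have hq0 : q j0 ⬝ᵥ q j0 = 0 := by
    have hc2 : c j0 ^ 2 ≠ 0 := pow_ne_zero 2 hj0
    have := (mul_eq_zero.mp hB0').resolve_left hc2
    rw [hw0, zero_dotProduct, zero_div, sub_zero] at this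
    exact this
  have hq0' : q j0 = 0 := dotProduct_self_eq_zero.mp hq0
  rcases hnz j0 with h | h
  · exact h hw0
  · exact h hq0'

/-! ## 2. The count `ζ ≤ n + 2m` (conditional on `hK`) -/

/-- **TWO-CLASS LAW at ratio 3 (conditional on the cube-root Loewner positivity `hK`).**  `A ∈ Sym(n)`, `C ∈ Sym(m)`, `B` any real
`n × m` matrix, `1 ≤ a`: a finite set `S` of positive `x`, each carrying a non-zero kernel vector `(w, q)` of
`[[A + x^a·1, B], [Bᵀ, C − x^{3a}·1]]`, has `#S ≤ n + 2m`. -/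
theorem card_posZeros_le_blocks_of_cubeLoewner
    (hK : ∀ (k : ℕ) (x c : Fin k → ℝ), (∀ i, 0 < x i) → Function.Injective x → c ≠ 0 →
      0 < ∑ j, ∑ l, c j * c l / (x j ^ 2 + x j * x l + x l ^ 2))
    (A : Matrix (Fin n) (Fin n) ℝ) (hA : A.IsSymm) (C : Matrix (Fin m) (Fin m) ℝ) (hC : C.IsSymm)
    (B : Matrix (Fin n) (Fin m) ℝ) (a : ℕ) (ha : 1 ≤ a) (S : Finset ℝ)
    (hS : ∀ x ∈ S, 0 < x ∧ ∃ w : Fin n → ℝ, ∃ q : Fin m → ℝ, (w ≠ 0 ∨ q ≠ 0) ∧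
      (A + (x ^ a) • (1 : Matrix (Fin n) (Fin n) ℝ)) *ᵥ w + B *ᵥ q = 0 ∧
      Bᵀ *ᵥ w + (C - (x ^ (3 * a)) • (1 : Matrix (Fin m) (Fin m) ℝ)) *ᵥ q = 0) :
    S.card ≤ n + 2 * m := by
  classical
  have hx : ∀ x : S, 0 < (x : ℝ) := fun x => (hS x x.2).1
  choose W Q hWQ using fun x : S => (hS x x.2).2
  have hpow3 : ∀ x : ℝ, x ^ (3 * a) = (x ^ a) ^ 3 := fun x => by rw [mul_comm, pow_mul]
  have hsinj : ∀ x y : S, (x : ℝ) ^ a = (y : ℝ) ^ a → x = y := by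
    intro x y h
    have ha0 : a ≠ 0 := by omega
    exact Subtype.ext ((pow_left_inj₀ (hx x).le (hx y).le ha0).mp h)
  have hid : ∀ x y : S, ((y : ℝ) ^ a - (x : ℝ) ^ a) * (W x ⬝ᵥ W y) =
      (((y : ℝ) ^ a) ^ 3 - ((x : ℝ) ^ a) ^ 3) * (Q x ⬝ᵥ Q y) := by
    intro x y
    have h := two_point_blocks A hA C hC B ((x : ℝ) ^ a) ((x : ℝ) ^ (3 * a)) ((y : ℝ) ^ a) ((y : ℝ) ^ (3 * a))
      (W x) (W y) (Q x) (Q y) (hWQ x).2.1 (hWQ x).2.2 (hWQ y).2.1 (hWQ y).2.2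
    rw [hpow3, hpow3] at h
    exact h
  let down : ℝ → Prop := fun x => if hxS : x ∈ S then
    W ⟨x, hxS⟩ ⬝ᵥ W ⟨x, hxS⟩ ≤ 3 * (x ^ a) ^ 2 * (Q ⟨x, hxS⟩ ⬝ᵥ Q ⟨x, hxS⟩) else False
  have hsplit := Finset.card_filter_add_card_filter_not (s := S) down
  -- downward zeros: at most m
  have hdown : (S.filter down).card ≤ m := by
    by_contra hlt
    push Not at hlt
    obtain ⟨T, hTsub, hTcard⟩ := Finset.exists_subset_card_eq (show m + 1 ≤ (S.filter down).card by omega)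
    have hTS : ∀ x ∈ T, x ∈ S := fun x hx => (Finset.mem_filter.mp (hTsub hx)).1
    have hTdown : ∀ x (hx : x ∈ T), W ⟨x, hTS x hx⟩ ⬝ᵥ W ⟨x, hTS x hx⟩ ≤
        3 * (x ^ a) ^ 2 * (Q ⟨x, hTS x hx⟩ ⬝ᵥ Q ⟨x, hTS x hx⟩) := by
      intro x hx
      have h := (Finset.mem_filter.mp (hTsub hx)).2
      simp only [down, dif_pos (hTS x hx)] at h
      exact h
    let e : Fin (m + 1) ≃ T := (T.equivFinOfCardEq hTcard).symm
    let emb : Fin (m + 1) → S := fun j => ⟨(e j : ℝ), hTS _ (e j).2⟩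
    have hembinj : Function.Injective emb := by
      intro j k h
      have h' : ((emb j : S) : ℝ) = ((emb k : S) : ℝ) := congrArg Subtype.val h
      exact e.injective (Subtype.ext h')
    refine down_card_le_blocks_of_cubeLoewner hK (fun j => ((emb j : S) : ℝ) ^ a) (fun j => pow_pos (hx (emb j)) a) ?_
      (fun j => W (emb j)) (fun j => Q (emb j)) (fun j => (hWQ (emb j)).1) ?_ ?_
    · intro j k h
      exact hembinj (hsinj _ _ h)
    · intro j k _
      exact hid (emb j) (emb k)
    · intro j
      exact hTdown (e j : ℝ) (e j).2
  -- upward zeros: at most n + m (the upward law of the third file)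
  have hupc : (S.filter fun x => ¬ down x).card ≤ n + m := by
    refine card_up_le_blocks A hA C hC B a ha _ ?_
    intro x hxm
    rw [Finset.mem_filter] at hxm
    obtain ⟨hxS, hxu⟩ := hxm
    simp only [down, dif_pos hxS, not_le] at hxu
    exact ⟨(hS x hxS).1, W ⟨x, hxS⟩, Q ⟨x, hxS⟩, (hWQ ⟨x, hxS⟩).2.1, (hWQ ⟨x, hxS⟩).2.2, hxu⟩
  omega

/-! ## 3. Determinant currency -/

/-- evaluation of the block pencil `[[A + X^a·1, B], [Bᵀ, C − X^{3a}·1]]` at a real point. -/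
theorem eval_blockPencil (A : Matrix (Fin n) (Fin n) ℝ) (C : Matrix (Fin m) (Fin m) ℝ) (B : Matrix (Fin n) (Fin m) ℝ)
    (a : ℕ) (x : ℝ) :
    (Polynomial.evalRingHom x).mapMatrix
        (Matrix.fromBlocks (A.map Polynomial.C + ((Polynomial.X : Polynomial ℝ) ^ a) • 1) (B.map Polynomial.C)
          (Bᵀ.map Polynomial.C) (C.map Polynomial.C - ((Polynomial.X : Polynomial ℝ) ^ (3 * a)) • 1)) =
      Matrix.fromBlocks (A + (x ^ a) • (1 : Matrix (Fin n) (Fin n) ℝ)) B Bᵀ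
        (C - (x ^ (3 * a)) • (1 : Matrix (Fin m) (Fin m) ℝ)) := by
  rw [RingHom.mapMatrix_apply, Matrix.fromBlocks_map]
  congr 1
  · ext i j
    by_cases h : i = j
    · subst h; simp
    · simp [Matrix.one_apply_ne h]
  · ext i j
    simp
  · ext i j
    simp
  · ext i j
    by_cases h : i = j
    · subst h; simp
    · simp [Matrix.one_apply_ne h]

/-- **TWO-CLASS LAW at ratio 3, determinant currency (conditional on `hK`).**  For `A ∈ Sym(n)`, `C ∈ Sym(m)`, any real `B`,
`1 ≤ a`, and granted the strict positive definiteness `hK` of the cube-root Loewner kernel, the determinant of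
`[[A + X^a·1, B], [Bᵀ, C − X^{3a}·1]]` has at most `n + 2m` distinct positive real roots. -/
theorem card_posRoots_det_blockPencil_le_of_cubeLoewner
    (hK : ∀ (k : ℕ) (x c : Fin k → ℝ), (∀ i, 0 < x i) → Function.Injective x → c ≠ 0 →
      0 < ∑ j, ∑ l, c j * c l / (x j ^ 2 + x j * x l + x l ^ 2))
    (A : Matrix (Fin n) (Fin n) ℝ) (hA : A.IsSymm) (C : Matrix (Fin m) (Fin m) ℝ) (hC : C.IsSymm)
    (B : Matrix (Fin n) (Fin m) ℝ) (a : ℕ) (ha : 1 ≤ a) :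
    ((Matrix.det (Matrix.fromBlocks (A.map Polynomial.C + ((Polynomial.X : Polynomial ℝ) ^ a) • 1) (B.map Polynomial.C)
          (Bᵀ.map Polynomial.C)
          (C.map Polynomial.C - ((Polynomial.X : Polynomial ℝ) ^ (3 * a)) • 1))).roots.toFinset.filter
        (fun x => 0 < x)).card ≤ n + 2 * m := by
  classical
  refine card_posZeros_le_blocks_of_cubeLoewner hK A hA C hC B a ha _ ?_
  intro x hx
  rw [Finset.mem_filter, Multiset.mem_toFinset, Polynomial.mem_roots'] at hx
  obtain ⟨⟨_, hroot⟩, hxpos⟩ := hx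
  refine ⟨hxpos, ?_⟩
  have hdet : (Matrix.fromBlocks (A + (x ^ a) • (1 : Matrix (Fin n) (Fin n) ℝ)) B Bᵀ
      (C - (x ^ (3 * a)) • (1 : Matrix (Fin m) (Fin m) ℝ))).det = 0 := by
    rw [← eval_blockPencil, ← RingHom.map_det]
    exact hroot
  obtain ⟨u, hu0, hu⟩ := Matrix.exists_mulVec_eq_zero_iff.mpr hdet
  rw [Matrix.fromBlocks_mulVec] at hu
  have h1 := congrFun hu
  refine ⟨u ∘ Sum.inl, u ∘ Sum.inr, ?_, ?_, ?_⟩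
  · by_contra hboth
    push Not at hboth
    apply hu0
    funext i
    rcases i with i | i
    · exact congrFun hboth.1 i
    · exact congrFun hboth.2 i
  · funext i
    have hi := h1 (Sum.inl i)
    simpa only [Sum.elim_inl, Pi.add_apply, Pi.zero_apply] using hi
  · funext i
    have hi := h1 (Sum.inr i)
    simpa only [Sum.elim_inr, Pi.add_apply, Pi.zero_apply] using hi

end MixedGauge

end Summit.ValiantsHypothesis.ValiantsHypothesis.Theorems.KPlusLogSqLaw
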